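import Mathlib
import Literature.MeasureTheory.Integral.HPolyhedronFacetSum
import HarnessLib

/-!
# Facet cut-offs for convex polytopes: a smooth `[0,1]`-cut-off `≡ 1` on a compact set, and null
# tie sets in facet charts (toward the lower half of the facet formula)

Topic `Literature/Analysis/Convexity`; namespace `Literature.Analysis.Convexity`.
Two plumbing lemmas for T2c (topology half) of the facet-formula programme
(`anisotropicPerimeter K P = Σ_F h_K(ν_F) area(F)` for convex polytopes, crystal3d-full eng MEMO-5/6):
* `exists_contDiff_cutoff_Icc` — for a compact `T` inside an open `O` of a finite-dimensional real
  normed space there is a `C¹` (indeed smooth) `χ : X → [0,1]` with compact support, `tsupport χ ⊆ O`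
  and `χ = 1` on `T` (Mathlib's smooth Urysohn lemma `exists_contMDiffMap_zero_one_nhds_of_isClosed`
  on the model space, keeping the range clause).
* `volume_chartTieSet_eq_zero` — in an isometric chart `Φ y = p + y₁U + y₂V` of the plane
  `⟪a, ·⟫ = b` (`(U, V, a)` orthonormal in coordinates), the tie set `{y | ⟪a', Φ y⟫ = b'}` of a
  constraint `(a', b')` that is NOT proportional to `(a, b)` is Lebesgue-null:
  it is an affine line, or empty — because `a' ⊥ U, V` forces `a' = ±a` (orthonormal frames of `ℝ³`
  span: `n = ⟪n, U×V⟫ U×V` for every `n ⊥ U, V`).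
[cite: EvansGariepy2015, Thm 5.16 (Gauss–Green), polyhedral case — plumbing]
-/

noncomputable section

namespace Literature.Analysis.Convexity

open _root_.MeasureTheory Set
open scoped Manifold ContDiff
open Literature.MeasureTheory.Integral (volume_affineLine_eq_zero)

/-- **Smooth `[0,1]`-cut-off `≡ 1` on a compact set.**
[cite: EvansGariepy2015, Thm 5.16 (Gauss–Green) — plumbing (smooth Urysohn)] -/
theorem exists_contDiff_cutoff_Icc {X : Type*} [NormedAddCommGroup X] [NormedSpace ℝ X]
    [FiniteDimensional ℝ X] {T O : Set X} (hT : IsCompact T) (hO : IsOpen O) (hTO : T ⊆ O) :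
    ∃ χ : X → ℝ, ContDiff ℝ 1 χ ∧ HasCompactSupport χ ∧ tsupport χ ⊆ O ∧ (∀ x ∈ T, χ x = 1) ∧
      ∀ x, 0 ≤ χ x ∧ χ x ≤ 1 := by
  obtain ⟨L, hL, hTL, hLO⟩ := exists_compact_between hT hO hTO
  obtain ⟨f, hf0, hf1, hf01⟩ :=
    exists_contMDiffMap_zero_one_nhds_of_isClosed (I := 𝓘(ℝ, X)) (M := X) (n := (⊤ : ℕ∞))
      isOpen_interior.isClosed_compl hT.isClosed (disjoint_compl_left_iff_subset.2 hTL)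
  have hsupp : Function.support (f : X → ℝ) ⊆ interior L := fun x hx => by
    by_contra hx'
    exact hx (hf0.self_of_nhdsSet x hx')
  have htsupp : tsupport (f : X → ℝ) ⊆ L :=
    (closure_mono hsupp).trans (closure_minimal interior_subset hL.isClosed)
  refine ⟨f, (contMDiff_iff_contDiff.1 f.contMDiff).of_le (by norm_cast),
    hL.of_isClosed_subset (isClosed_tsupport _) htsupp, htsupp.trans hLO,
    fun x hx => hf1.self_of_nhdsSet x hx, fun x => ⟨(hf01 x).1, (hf01 x).2⟩⟩

/-- Orthonormal frames of `ℝ³` span: if `(U, V)` is orthonormal (in coordinates) and `n ⊥ U, V`, then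
`n = ⟪n, w⟫ w` with `w = U × V`, and `‖w‖ = 1`. [cite: EvansGariepy2015, Thm 5.16 — plumbing] -/
theorem eq_inner_cross_smul_of_perp (U V n : Fin 3 → ℝ) (hU1 : ∑ l, U l ^ 2 = 1)
    (hV1 : ∑ l, V l ^ 2 = 1) (hUV : ∑ l, U l * V l = 0) (hnU : ∑ l, n l * U l = 0)
    (hnV : ∑ l, n l * V l = 0) :
    let w1 := U 1 * V 2 - U 2 * V 1
    let w2 := U 2 * V 0 - U 0 * V 2
    let w3 := U 0 * V 1 - U 1 * V 0
    (w1 ^ 2 + w2 ^ 2 + w3 ^ 2 = 1) ∧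
    n 0 = (n 0 * w1 + n 1 * w2 + n 2 * w3) * w1 ∧ n 1 = (n 0 * w1 + n 1 * w2 + n 2 * w3) * w2 ∧
    n 2 = (n 0 * w1 + n 1 * w2 + n 2 * w3) * w3 := by
  intro w1 w2 w3
  simp only [Fin.sum_univ_three] at hU1 hV1 hUV hnU hnV
  have hw : w1 ^ 2 + w2 ^ 2 + w3 ^ 2 = 1 := by
    simp only [w1, w2, w3]
    linear_combination (V 0 ^ 2 + V 1 ^ 2 + V 2 ^ 2) * hU1 + hV1 -
      (U 0 * V 0 + U 1 * V 1 + U 2 * V 2) * hUV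
  have E1 : n 1 * w3 - n 2 * w2 = 0 := by
    simp only [w2, w3]; linear_combination U 0 * hnV - V 0 * hnU
  have E2 : n 2 * w1 - n 0 * w3 = 0 := by
    simp only [w1, w3]; linear_combination U 1 * hnV - V 1 * hnU
  have E3 : n 0 * w2 - n 1 * w1 = 0 := by
    simp only [w1, w2]; linear_combination U 2 * hnV - V 2 * hnU
  refine ⟨hw, ?_, ?_, ?_⟩
  · linear_combination (-(n 0)) * hw + w2 * E3 - w3 * E2
  · linear_combination (-(n 1)) * hw - w1 * E3 + w3 * E1
  · linear_combination (-(n 2)) * hw + w1 * E2 - w2 * E1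

/-- **Tie sets in a facet chart are null.**  For the chart `Φ y = p + y₁U + y₂V` of the plane
`Σ a_l x_l = b` (`(U, V, a)` orthonormal, `Σ a_l p_l = b`) and a constraint `(a', b')` not
proportional to `(a, b)`: `|{y | Σ a'_l (Φ y)_l = b'}| = 0`.
[cite: EvansGariepy2015, Thm 5.16 (Gauss–Green), polyhedral case — plumbing] -/
theorem volume_chartTieSet_eq_zero (a a' p U V : Fin 3 → ℝ) (b b' : ℝ)
    (ha1 : ∑ l, a l ^ 2 = 1)
    (hnd : ¬ ∃ μ : ℝ, (∀ l, a' l = μ * a l) ∧ b' = μ * b)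
    (hp : ∑ l, a l * p l = b) (hU : ∑ l, a l * U l = 0) (hV : ∑ l, a l * V l = 0)
    (hU1 : ∑ l, U l ^ 2 = 1) (hV1 : ∑ l, V l ^ 2 = 1) (hUV : ∑ l, U l * V l = 0) :
    volume {y : ℝ × ℝ | ∑ l, a' l * (p + y.1 • U + y.2 • V) l = b'} = 0 := by
  -- the constraint is affine in the chart
  have hlin : ∀ y : ℝ × ℝ, ∑ l, a' l * (p + y.1 • U + y.2 • V) l =
      (∑ l, a' l * U l) * y.1 + (∑ l, a' l * V l) * y.2 + ∑ l, a' l * p l := by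
    intro y
    have : ∀ l, a' l * (p + y.1 • U + y.2 • V) l =
        a' l * U l * y.1 + a' l * V l * y.2 + a' l * p l := by
      intro l; simp [smul_eq_mul]; ring
    simp_rw [this, Finset.sum_add_distrib, ← Finset.sum_mul]
  have hset : {y : ℝ × ℝ | ∑ l, a' l * (p + y.1 • U + y.2 • V) l = b'} =
      {y : ℝ × ℝ | (∑ l, a' l * U l) * y.1 + (∑ l, a' l * V l) * y.2 = b' - ∑ l, a' l * p l} := by
    ext y; simp only [Set.mem_setOf_eq, hlin]; constructor <;> intro h <;> linarith
  rw [hset]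
  by_cases hne : (∑ l, a' l * U l) ≠ 0 ∨ (∑ l, a' l * V l) ≠ 0
  · exact volume_affineLine_eq_zero hne
  · -- degenerate: `a' ⊥ U, V`, hence `a' = ±a`, contradicting non-proportionality unless the set is empty
    have h1 : ∑ l, a' l * U l = 0 := by by_contra h; exact hne (Or.inl h)
    have h2 : ∑ l, a' l * V l = 0 := by by_contra h; exact hne (Or.inr h)
    obtain ⟨hw, ha0, ha1', ha2⟩ := eq_inner_cross_smul_of_perp U V a hU1 hV1 hUV hU hV
    obtain ⟨-, hb0, hb1, hb2⟩ := eq_inner_cross_smul_of_perp U V a' hU1 hV1 hUV h1 h2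
    obtain ⟨w1, hw1⟩ : ∃ w1 : ℝ, w1 = U 1 * V 2 - U 2 * V 1 := ⟨_, rfl⟩
    obtain ⟨w2, hw2⟩ : ∃ w2 : ℝ, w2 = U 2 * V 0 - U 0 * V 2 := ⟨_, rfl⟩
    obtain ⟨w3, hw3⟩ : ∃ w3 : ℝ, w3 = U 0 * V 1 - U 1 * V 0 := ⟨_, rfl⟩
    rw [← hw1, ← hw2, ← hw3] at hw ha0 ha1' ha2 hb0 hb1 hb2
    obtain ⟨s, hs⟩ : ∃ s : ℝ, s = a 0 * w1 + a 1 * w2 + a 2 * w3 := ⟨_, rfl⟩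
    obtain ⟨s', hs'⟩ : ∃ s' : ℝ, s' = a' 0 * w1 + a' 1 * w2 + a' 2 * w3 := ⟨_, rfl⟩
    rw [← hs] at ha0 ha1' ha2
    rw [← hs'] at hb0 hb1 hb2
    simp only [Fin.sum_univ_three] at ha1 hp
    have hs2 : s ^ 2 = 1 := by
      have : a 0 ^ 2 + a 1 ^ 2 + a 2 ^ 2 = s ^ 2 * (w1 ^ 2 + w2 ^ 2 + w3 ^ 2) := by
        rw [ha0, ha1', ha2]; ring
      rw [hw, mul_one] at this; rw [← this, ha1]
    -- `a' = μ a` with `μ = s' s` (`s² = 1`)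
    have hμ : ∀ l, a' l = (s' * s) * a l := by
      intro l
      fin_cases l
      · show a' 0 = s' * s * a 0
        rw [hb0, ha0]; linear_combination (-(s' * w1)) * hs2
      · show a' 1 = s' * s * a 1
        rw [hb1, ha1']; linear_combination (-(s' * w2)) * hs2
      · show a' 2 = s' * s * a 2
        rw [hb2, ha2]; linear_combination (-(s' * w3)) * hs2
    -- the tie set is `{y | 0 = b' - μ b}`: empty by non-proportionality
    have hp' : ∑ l, a' l * p l = s' * s * b := by
      simp only [Fin.sum_univ_three, hμ]; rw [← hp]; ring
    have hne' : b' - ∑ l, a' l * p l ≠ 0 := by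
      rw [hp']
      intro h0
      exact hnd ⟨s' * s, hμ, by linarith⟩
    have hempty : {y : ℝ × ℝ | (∑ l, a' l * U l) * y.1 + (∑ l, a' l * V l) * y.2 =
        b' - ∑ l, a' l * p l} = ∅ := by
      ext y
      simp only [Set.mem_setOf_eq, Set.mem_empty_iff_false, iff_false, h1, h2, zero_mul, add_zero]
      exact fun h => hne' h.symm
    rw [hempty, measure_empty]

end Literature.Analysis.Convexity

end
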